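import Summits.ABC.ABC.Theses.FeketeScales
import Summits.ABC.ABC.Theorems.FeketeScalesAssembly
import Summits.ABC.ABC.Theorems.FeketeScalesSubmultOfRST
import Summits.ABC.ABC.Theorems.FeketeScalesTargetOfRST
import Summits.ABC.ABC.Theorems.FeketeScalesTargetOmegaSplit
import Literature.NumberTheory.DiophantineGeometry.AbcWave0SUnitProofs
import Literature.Barriers.ABC.EpsilonCannotBeDroppedHolds
import Literature.Barriers.ABC.EpsilonCannotBeDroppedProofs
import Literature.Barriers.ABC.ExplicitABCQualityFloor
import Summits.ABC.ABC.Theorems.Target.Negative.TailExponentFloor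
import Summits.ABC.ABC.Theorems.Target.Negative.NoLinearGoodScales

/-!
# Disproof of `Target` (crux stmt-ABC-2159, route ABC/FeketeScales) — findings of the cdisprove seat (v4)

Crux: `Target := ScaleSubmultiplicativity ∧ SparseGoodScales` (definitionally, `target_iff`), i.e.
(1) SCALE SUB-MULTIPLICATIVITY of the extremal height `G(R) = max{c : abc triple, rad(abc) ≤ R}` with
sub-power slack `exp((log R₁R₂)^θ)`, `θ < 1`, stated `G`-free, and (2) SPARSE GOOD SCALES
(`c ≤ R^{1+δ}` for all triples of radical `≤ R`, for arbitrarily large `R`, every `δ > 0`).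

READ-BACK (W.lean, rc 0): `Real.log ((R₁:ℝ) * R₂) ^ θ` parses as `(log (R₁R₂)) ^ θ` (`Real.rpow`, base
`> 0` once `R₀ ≥ 2`); `c₁ c₂` are cast `ℕ → ℝ`; `rad` is Mathlib's `radical` computed in `ℕ`; `IsABCTriple`
demands `0 < a`, `0 < b`, `a + b = c`, `Nat.Coprime a b`. No junk value is reachable by the ∀-bound data;
the ∃-bound data (`θ, K, R₀`, resp. `R`) are the prover's. `R₀ ≤ 1` is impossible (§3a), harmless.

VERDICT (cycle 1): the crux RESISTS an unconditional disproof, for a reason that is a theorem of the tree: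
`RSTConjectureAUpper → Target → ABC` (§2: `target_of_rstConjectureAUpper`, `abc_of_target`). Hence
`¬ Target → ¬ RSTConjectureAUpper` (`not_rstConjectureAUpper_of_not_target`): every disproof of the crux
disproves Robert–Stewart–Tenenbaum's Conjecture A (upper half), an open conjecture believed TRUE, whose only
known lower families (Stewart–Tijdeman / van Frankenhuijsen / Bright, excess `≍ √L/log log L`, and the
`P`-unit polylog families) sit far below it. Conjunct 2 alone is implied by `ABC`
(`not_abc_of_not_sparseGoodScales`), conjunct 1 alone by every pointwise sub-power slack
(`not_subPowerSlack_of_not_scaleSubmult`). Neither conjunct is decidable by finite computation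
(route review 3bae3c4d: ¬(1) needs `G` at infinitely many scales, ¬(2) = abc failing at EVERY large scale).

WHAT IS PROVED FALSE here (load-bearing analysis, §3): the threshold `R₀` (any `R₀ ≤ 1` kills (1):
no abc triple has radical `≤ 1`), the localisation `rad(abc) ≤ R₁R₂` (without it (1) bounds all heights by
finitely many, S-unit finiteness `abc.S25` being a theorem of the tree), and coprimality in (2)
(`(2ⁿ, 2ⁿ, 2ⁿ⁺¹)` has radical 2). §4: the `δ = 0` form of (2) is false with any constant EVEN SPARSELY —
LANDED negative lemma `Theorems/Target/Negative/NoLinearGoodScales.lean` (`exists_triple_linear_excess`: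
`lim inf G(R)/R = +∞`, every large scale carries a triple `(5^e, 9^i − 5^e, 9^i)` with `2^{k+2} ∣ b`, by the
2-adic discrete logarithm to base 5; `not_sparseGoodScales_exponent_one`; quantitatively `G(R) > R log R/600` at every scale,
`LogExcessEveryScale.lean`, p109219), imported in §4 — so the `δ > 0`
of conjunct 2 is load-bearing in the strongest sense (no printed family gave ALL scales; Granville–Tucker /
Stewart–Tijdeman give some). The pointwise floor `τ ≥ 1/2`
(`not_subPowerSlack_of_lt_half`, crux workfile SketchIdeator2) does NOT transfer to the ratio statement (1):
`SSM(θ)` with `θ < 1/2` is not refuted by any known family (ratios `G(R₁R₂)/(G(R₁)G(R₂))` are only bounded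
ABOVE by `16·exp(max excess)`), so (1) has no proved exponent floor — information for provers.

LINE SketchIdeator2 (ω-split; stubs `stub_bakerRefinement`, `stub_ultraCompositeTail`), §5: joint
sufficiency is the tree theorem `Target.target_of_bakerShape_of_tail` (nothing smuggled: both stubs are
used — few-prime triples are outside the tail, and Baker's allowance at `ω ≍ L/log L` is not sub-power).
Stub 1 needs `κ > 1.1997` (tree: `BakerShapeConstantFloor`, Reyssat's triple). Stub 2 (UCT): its exponent
window is `θ ≥ 1/2` EVEN ON THE TAIL — LANDED as `Theorems/Target/Negative/ForcedDivisor.lean` (p100231,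
`exists_triple_cform_forced`: Stewart–Tijdeman's pigeonhole modulo `2^k·D` with a forced divisor `D ∣ b`)
and `Theorems/Target/Negative/TailExponentFloor.lean` (p104039; `exists_tail_triple`,
`not_tail_subpower_of_lt_half`, `half_le_of_tail_subpower`): for ALL `θ', θ < 1/2` the tail statement is false (`D` = `⌊y^{2τ}⌋ + 2` primes
from `(y, 2y]` costs only `log D = o(y/log y)` of the excess `(3/2) y/log y`); imported in §5 as
`not_tailSubPower_of_lt_half`, `stub2_exponent_floor`, `stub2_window`. For `θ ≥ 1/2` a refutation of the
stub would again refute `RSTConjectureAUpper`.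

COMPUTE (card E1(b), the route's kill criterion (b); kit jobs j016700 (rad ≤ 10^6) and j016701 (rad ≤ 10^7 =
von Känel–Matschke's range D1), script `compute/job/main.py`, evidence on this item; §6): from an independently
enumerated table of ALL abc triples with `rad ≤ 10^7`, `c ≤ rad-bound^{1.7}` (432 408 triples, 5 445 hits
`c > rad`, 25 record steps of `G`; brute-force cross-check on `c ≤ 3000` exact; completeness beyond the quality
cut-off 1.7 rests on vKM's certified maximum quality 1.6299): the sub-multiplicativity constant
`log K(R₀, θ) = max log[G(R₁R₂)/(e^{(log R₁R₂)^θ} G(R₁)G(R₂))]` over `R₀ ≤ R₁ ≤ R₂`, `R₁R₂ ≤ 10^7` is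
DECREASING in `R₀`: pure ratio (no slack) 5.10 (`R₀ ≤ 24`: Reyssat's `G(15048) = 6436343` against
`G(22) = 9`, `G(684) = 4375`) → 4.05 (32–64) → 3.72 (128) → 3.46 (256–512) → 3.05 (1024) → 0.85 (2048) →
0.13 (3072); `θ = 1/2`: 2.00 → 0.84 → 0.08 → −0.34 → −0.75 → −3.0 → −3.9; `θ = 3/4`: 0.47 → −1.5 → −2.3 →
−3.95 → −4.4 → −6.6 → −7.9. By product scale (`R₁, R₂ ≥ 8`, dyadic `R₁R₂ ∈ [2^j, 2^{j+1})`, `j = 13…23`) the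
max pure log-ratio reads 5.10, 5.10, 4.50, 4.50, 3.07, 2.42, 2.35, 3.72, 3.45, 2.94, 2.93 — no growth. So
criterion (b) does NOT fire on D1 (`K(2, pure) = e^{5.10} ≈ 164 < 360`, the card's F2 threshold), the troughs of
`G(R)/R` are moderate (ratio of dyadic min to max of `G(R)/R` between 0.06 and 0.85; min `G(R)/R` rises from 0.31 at
`R = 29` to 825 at `10^7`), and the good-scale exponent `δ(R) = log G(R)/log R − 1` has dyadic minima 0.36–0.50 on `[2^18, 10^7]`
(`δ(10^7) = 0.4167`, record `(283, 5^13·…, 8251953408)`, q = 1.5808). Evidence, not proof: consistent with the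
crux; says nothing about bursts beyond `10^7`. For the line's ω-split the range is uninformative: at
`rad ≤ 10^7` (`L = log rad ≤ 16.1`) the tail condition `ω(abc) > L^{θ'}` holds for 99% (`θ' = 0.5`), 72%
(`θ' = 0.6`), 17% (`θ' = 0.7`) of all triples, the maximal excess `E = log(c/rad)` is 8.39 (`ω = 6`, the
record at `R = 1876290`), `max E/√L = 2.21`, `max E/L^{3/4} = 1.14`, and the mean excess of the 5 445 hits
INCREASES with `ω` from 1.03 (`ω = 4`) to 1.43 (`ω = 7`) (`compute/omega_tail.py`, local, on j016701's table).
-/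

set_option linter.unusedVariables false
set_option linter.dupNamespace false

namespace Summit.ABC.ABC.Cruxes.Target.Disproof

open Literature.NumberTheory.DiophantineGeometry
open Summit.ABC.ABC.Theses.FeketeScales
open UniqueFactorizationMonoid Finset

/-! ## §1 Read-back -/

/-- The crux is definitionally the conjunction of the two ranked cruxes. -/
theorem target_iff : Target ↔ ScaleSubmultiplicativity ∧ SparseGoodScales := Iff.rfl

/-- Negation normal form: a disproof must break one conjunct. -/
theorem not_target_iff : ¬ Target ↔ (¬ ScaleSubmultiplicativity ∨ ¬ SparseGoodScales) := by
  rw [target_iff, not_and_or]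

/-- Every abc triple has radical at least `2` (`abc ≥ 2`). -/
theorem two_le_rad {a b c : ℕ} (h : IsABCTriple a b c) : 2 ≤ rad a b c := by
  obtain ⟨ha, hb, habc, -⟩ := h
  rw [rad_def, Nat.two_le_radical_iff]
  calc 2 ≤ c := by omega
    _ ≤ a * b * c := Nat.le_mul_of_pos_left c (Nat.mul_pos ha hb)

/-- The smallest triple. -/
theorem isABCTriple_one_one_two : IsABCTriple 1 1 2 :=
  ⟨one_pos, one_pos, rfl, Nat.coprime_one_left 1⟩

theorem rad_one_one_two : rad 1 1 2 = 2 := by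
  rw [rad_def, show (1 * 1 * 2 : ℕ) = 2 from rfl, radical_of_prime Nat.prime_two.prime, normalize_eq]

/-! ## §2 The sandwich `RSTConjectureAUpper ⟹ Target ⟹ ABC` — why there is no unconditional kill -/

/-- `Target ⟹ ABC` (the route's Assembly, proved in the tree). -/
theorem abc_of_target : Target → _root_.ABC := fun h =>
  Summit.ABC.ABC.Theorems.feketeScales_assembly_proof h.1 h.2

/-- `RSTConjectureAUpper ⟹ Target` (tree). -/
theorem target_of_rstConjectureAUpper : Literature.Barriers.ABC.RSTConjectureAUpper → Target :=
  Summit.ABC.ABC.Theorems.Target.target_of_rstConjectureAUpper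

/-- **Barrier reduction.** Any disproof of the crux is a disproof of Robert–Stewart–Tenenbaum's
Conjecture A, upper half (open; believed true). -/
theorem not_rstConjectureAUpper_of_not_target (h : ¬ Target) :
    ¬ Literature.Barriers.ABC.RSTConjectureAUpper :=
  fun hR => h (target_of_rstConjectureAUpper hR)

/-- Conversely a disproof of `ABC` disproves the crux (so the crux is sandwiched between two open
conjectures). -/
theorem not_target_of_not_abc (h : ¬ _root_.ABC) : ¬ Target := fun hT => h (abc_of_target hT)

/-- Conjunct 2 is implied by `ABC` (tree). -/
theorem sparseGoodScales_of_abc : _root_.ABC → SparseGoodScales :=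
  Summit.ABC.ABC.Theorems.Target.sparseGoodScales_of_abc

/-- A disproof of conjunct 2 is a disproof of `ABC`. -/
theorem not_abc_of_not_sparseGoodScales (h : ¬ SparseGoodScales) : ¬ _root_.ABC :=
  fun hA => h (sparseGoodScales_of_abc hA)

/-- A disproof of conjunct 1 refutes EVERY pointwise sub-power slack `c < rad·exp(A (log rad)^τ)`,
`τ < 1` (the route's support item `SubmultOfRST`, proved in the tree), hence again RST-A. -/
theorem not_subPowerSlack_of_not_scaleSubmult (h : ¬ ScaleSubmultiplicativity) :
    ¬ ∃ τ : ℝ, τ < 1 ∧ ∃ A : ℝ, ∀ a b c : ℕ, IsABCTriple a b c →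
      (c : ℝ) < ((rad a b c : ℕ) : ℝ) * Real.exp (A * Real.log ((rad a b c : ℕ) : ℝ) ^ τ) :=
  fun hS => h (Summit.ABC.ABC.Theorems.submultOfRST_proof hS)

/-! ## §3 Load-bearing hypotheses -/

/-- Conjunct 1's body at fixed data `(θ, K, R₀)`. -/
def SSMWith (θ K : ℝ) (R₀ : ℕ) : Prop :=
  ∀ R₁ R₂ : ℕ, R₀ ≤ R₁ → R₀ ≤ R₂ → ∀ a b c : ℕ, IsABCTriple a b c → rad a b c ≤ R₁ * R₂ →
    ∃ a₁ b₁ c₁ a₂ b₂ c₂ : ℕ, IsABCTriple a₁ b₁ c₁ ∧ rad a₁ b₁ c₁ ≤ R₁ ∧ IsABCTriple a₂ b₂ c₂ ∧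
      rad a₂ b₂ c₂ ≤ R₂ ∧ (c : ℝ) ≤ K * Real.exp (Real.log ((R₁ : ℝ) * R₂) ^ θ) * c₁ * c₂

theorem scaleSubmultiplicativity_iff :
    ScaleSubmultiplicativity ↔ ∃ θ : ℝ, θ < 1 ∧ ∃ K : ℝ, 0 < K ∧ ∃ R₀ : ℕ, SSMWith θ K R₀ := Iff.rfl

/-- The threshold is monotone (larger `R₀` = weaker claim). -/
theorem ssmWith_mono {θ K : ℝ} {R₀ R₀' : ℕ} (h : SSMWith θ K R₀) (hle : R₀ ≤ R₀') : SSMWith θ K R₀' :=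
  fun R₁ R₂ h₁ h₂ => h R₁ R₂ (hle.trans h₁) (hle.trans h₂)

/-- **(3a) `R₀ ≥ 2` is forced**: with `R₀ ≤ 1` the scale `R₁ = 1` carries no abc triple at all
(every radical is `≥ 2`), while `(1,1,2)` lives at scale `R₁R₂ = 2`. -/
theorem ssmWith_false_of_threshold_le_one (θ K : ℝ) {R₀ : ℕ} (hR₀ : R₀ ≤ 1) : ¬ SSMWith θ K R₀ := by
  intro h
  obtain ⟨a₁, b₁, c₁, -, -, -, h₁, hr₁, -⟩ :=
    h 1 2 hR₀ (by omega) 1 1 2 isABCTriple_one_one_two (by rw [rad_one_one_two])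
  have := two_le_rad h₁
  omega

/-- Conjunct 1 with the threshold removed altogether. -/
def ScaleSubmultNoThreshold : Prop :=
  ∃ θ : ℝ, θ < 1 ∧ ∃ K : ℝ, 0 < K ∧ SSMWith θ K 0

/-- **(3a')** … which is therefore false. -/
theorem scaleSubmult_false_without_threshold : ¬ ScaleSubmultNoThreshold := by
  rintro ⟨θ, -, K, -, h⟩
  exact ssmWith_false_of_threshold_le_one θ K (Nat.zero_le 1) h

/-- The set of abc triples of radical `≤ R` is finite (S-unit finiteness `abc.S25`, a theorem of the
tree: `finite_setOf_isABCTriple_primeFactors_subset_holds`). -/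
theorem finite_triples_rad_le (R : ℕ) :
    {t : ℕ × ℕ × ℕ | IsABCTriple t.1 t.2.1 t.2.2 ∧ rad t.1 t.2.1 t.2.2 ≤ R}.Finite := by
  refine (finite_setOf_isABCTriple_primeFactors_subset_holds (Finset.range (R + 1))).subset ?_
  rintro ⟨a, b, c⟩ ⟨habc, hrad⟩
  dsimp only at habc hrad ⊢
  refine ⟨habc, fun p hp => ?_⟩
  have hdvd : p ∣ radical (a * b * c) := by
    rw [Nat.radical_eq_prod_primeFactors]; exact dvd_prod_of_mem _ hp
  have hle : p ≤ radical (a * b * c) := Nat.le_of_dvd (Nat.radical_pos _) hdvd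
  have hrad' : radical (a * b * c) ≤ R := hrad
  exact Finset.mem_range.mpr (by omega)

/-- Hence the heights at a fixed scale are bounded: `G(R) < ∞`. -/
theorem exists_bound_c_rad_le (R : ℕ) :
    ∃ M : ℕ, ∀ a b c : ℕ, IsABCTriple a b c → rad a b c ≤ R → c ≤ M := by
  obtain ⟨T, hT⟩ := (finite_triples_rad_le R).exists_finset
  refine ⟨T.sup fun t => t.2.2, fun a b c habc hrad => ?_⟩
  have hmem : (a, b, c) ∈ T := (hT (a, b, c)).mpr ⟨habc, hrad⟩
  exact Finset.le_sup (f := fun t : ℕ × ℕ × ℕ => t.2.2) hmem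

/-- Conjunct 1 with the localisation `rad(abc) ≤ R₁R₂` removed. -/
def ScaleSubmultNoRadBound : Prop :=
  ∃ θ : ℝ, θ < 1 ∧ ∃ K : ℝ, 0 < K ∧ ∃ R₀ : ℕ, ∀ R₁ R₂ : ℕ, R₀ ≤ R₁ → R₀ ≤ R₂ →
    ∀ a b c : ℕ, IsABCTriple a b c →
      ∃ a₁ b₁ c₁ a₂ b₂ c₂ : ℕ, IsABCTriple a₁ b₁ c₁ ∧ rad a₁ b₁ c₁ ≤ R₁ ∧ IsABCTriple a₂ b₂ c₂ ∧
        rad a₂ b₂ c₂ ≤ R₂ ∧ (c : ℝ) ≤ K * Real.exp (Real.log ((R₁ : ℝ) * R₂) ^ θ) * c₁ * c₂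

/-- The triples `(1, n, n+1)`. -/
theorem isABCTriple_one_succ {n : ℕ} (hn : 0 < n) : IsABCTriple 1 n (n + 1) :=
  ⟨one_pos, hn, by omega, Nat.coprime_one_left n⟩

/-- **(3b) the localisation `rad(abc) ≤ R₁R₂` is load-bearing**: without it conjunct 1 bounds EVERY
height `c` by `K·slack·G(R₁)·G(R₂) < ∞`, absurd along `(1, n, n+1)`. -/
theorem scaleSubmult_false_without_radBound : ¬ ScaleSubmultNoRadBound := by
  rintro ⟨θ, -, K, hK, R₀, h⟩
  obtain ⟨M, hM⟩ := exists_bound_c_rad_le R₀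
  set S : ℝ := K * Real.exp (Real.log ((R₀ : ℝ) * R₀) ^ θ) with hS
  have hS0 : 0 < S := mul_pos hK (Real.exp_pos _)
  -- a height above `S · M · M`
  obtain ⟨n, hn⟩ := exists_nat_gt (S * M * M)
  obtain ⟨a₁, b₁, c₁, a₂, b₂, c₂, h₁, hr₁, h₂, hr₂, hle⟩ :=
    h R₀ R₀ le_rfl le_rfl 1 (n + 1) (n + 1 + 1) (isABCTriple_one_succ (Nat.succ_pos n))
  have hc₁ : (c₁ : ℝ) ≤ M := by exact_mod_cast hM a₁ b₁ c₁ h₁ hr₁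
  have hc₂ : (c₂ : ℝ) ≤ M := by exact_mod_cast hM a₂ b₂ c₂ h₂ hr₂
  have hbound : S * c₁ * c₂ ≤ S * M * M := by
    have := mul_le_mul hc₁ hc₂ (Nat.cast_nonneg _) (Nat.cast_nonneg _)
    calc S * c₁ * c₂ = S * (c₁ * c₂) := by ring
      _ ≤ S * (M * M) := mul_le_mul_of_nonneg_left this hS0.le
      _ = S * M * M := by ring
  have hlt : (n : ℝ) < ((n + 1 + 1 : ℕ) : ℝ) := by push_cast; linarith
  have := hle.trans hbound
  linarith

/-- Conjunct 2 with coprimality dropped from the notion of triple. -/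
def SparseGoodScalesNonCoprime : Prop :=
  ∀ δ : ℝ, 0 < δ → ∀ N : ℕ, ∃ R : ℕ, N ≤ R ∧ ∀ a b c : ℕ, 0 < a → 0 < b → a + b = c →
    rad a b c ≤ R → (c : ℝ) ≤ (R : ℝ) ^ (1 + δ)

theorem rad_two_pow (i j k : ℕ) (hk : 0 < k) : rad (2 ^ i) (2 ^ j) (2 ^ k) = 2 := by
  rw [rad_def, ← pow_add, ← pow_add, radical_pow_of_prime Nat.prime_two.prime (by omega), normalize_eq]

/-- **(3c) coprimality is load-bearing for conjunct 2**: `(2ⁿ, 2ⁿ, 2ⁿ⁺¹)` has radical `2` and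
unbounded height, so no scale `R ≥ 2` is good. -/
theorem sparseGoodScales_false_without_coprime : ¬ SparseGoodScalesNonCoprime := by
  intro h
  obtain ⟨R, hR2, hR⟩ := h 1 one_pos 2
  have hle := hR (2 ^ (2 * R - 1)) (2 ^ (2 * R - 1)) (2 ^ (2 * R)) (pow_pos two_pos _)
    (pow_pos two_pos _) (by rw [← two_mul, ← pow_succ']; congr 1; omega)
    (by rw [rad_two_pow _ _ _ (by omega)]; exact hR2)
  have hlt : (R : ℝ) < 2 ^ R := by exact_mod_cast Nat.lt_two_pow_self
  have hR0 : (0 : ℝ) ≤ R := Nat.cast_nonneg R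
  have h1 : ((2 ^ (2 * R) : ℕ) : ℝ) = (2 ^ R) ^ 2 := by push_cast; rw [← pow_mul, mul_comm]
  have h2 : (R : ℝ) ^ ((1 : ℝ) + 1) = (R : ℝ) ^ 2 := by norm_num [Real.rpow_two]
  rw [h1, h2] at hle
  nlinarith

/-! ## §4 Natural strengthenings of conjunct 2 -/

/-- **(4a) `δ = 0` fails at ALL large scales with any constant** (Granville–Tucker's
`(1, 2^{p(p−1)} − 1, 2^{p(p−1)})`, tree: `abc_no_uniform_constant`): there are no `C, N` with
`c ≤ C·R` for every triple of radical `≤ R` and every `R ≥ N`. (Superseded by (4a') below, which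
refutes even the SPARSE `δ = 0` form; kept as the one-line Granville–Tucker argument.) -/
theorem not_allScales_linear :
    ¬ ∃ C : ℝ, ∃ N : ℕ, ∀ R : ℕ, N ≤ R → ∀ a b c : ℕ, IsABCTriple a b c → rad a b c ≤ R →
      (c : ℝ) ≤ C * R := by
  rintro ⟨C, N, h⟩
  obtain ⟨a, b, c, habc, hlt⟩ :=
    Literature.Barriers.ABC.abc_no_uniform_constant (max C 0 * max (N : ℝ) 1)
  have hC : C ≤ max C 0 := le_max_left _ _
  have hC0 : 0 ≤ max C 0 := le_max_right _ _
  have hN1 : (1 : ℝ) ≤ max (N : ℝ) 1 := le_max_right _ _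
  have hrad1 : (1 : ℝ) ≤ rad a b c := by exact_mod_cast le_trans (by norm_num) (two_le_rad habc)
  rcases le_or_gt N (rad a b c) with hle | hgt
  · have h1 := h (rad a b c) hle a b c habc le_rfl
    have : C * (rad a b c : ℝ) ≤ max C 0 * max (N : ℝ) 1 * rad a b c := by
      calc C * (rad a b c : ℝ) ≤ max C 0 * rad a b c := by gcongr
        _ = max C 0 * 1 * rad a b c := by ring
        _ ≤ max C 0 * max (N : ℝ) 1 * rad a b c := by gcongr
    linarith
  · have h1 := h N le_rfl a b c habc hgt.le
    have hNle : (N : ℝ) ≤ max (N : ℝ) 1 := le_max_left _ _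
    have : C * (N : ℝ) ≤ max C 0 * max (N : ℝ) 1 * rad a b c := by
      calc C * (N : ℝ) ≤ max C 0 * N := by gcongr
        _ ≤ max C 0 * max (N : ℝ) 1 := by gcongr
        _ = max C 0 * max (N : ℝ) 1 * 1 := by ring
        _ ≤ max C 0 * max (N : ℝ) 1 * rad a b c := by gcongr
    linarith

/-- **(4a') `δ = 0` fails even SPARSELY** (landed: `Target.Negative.not_sparseGoodScales_exponent_one`,
`exists_triple_linear_excess` — `lim inf G(R)/R = +∞`): there is no constant `C` and no unbounded set of
scales `R` on which `c ≤ C·R` for all triples of radical `≤ R`. -/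
theorem not_sparseScales_linear :
    ¬ ∃ C : ℝ, ∀ N : ℕ, ∃ R : ℕ, N ≤ R ∧ ∀ a b c : ℕ, IsABCTriple a b c → rad a b c ≤ R →
      (c : ℝ) ≤ C * R :=
  Summit.ABC.ABC.Theorems.Target.Negative.not_sparseGoodScales_exponent_one

/-- … in particular conjunct 2 at `δ = 0` verbatim (`R^{1+0}`) is false. -/
theorem not_sparseGoodScales_at_delta_zero :
    ¬ ∀ N : ℕ, ∃ R : ℕ, N ≤ R ∧ ∀ a b c : ℕ, IsABCTriple a b c → rad a b c ≤ R →
      (c : ℝ) ≤ (R : ℝ) ^ ((1 : ℝ) + 0) :=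
  Summit.ABC.ABC.Theorems.Target.Negative.not_sparseGoodScales_delta_zero

/-- **Every large scale is linearly bad**: `∀ C, ∃ N, ∀ R ≥ N, G(R) > C R` (landed). -/
theorem linear_excess_at_every_scale (C : ℝ) :
    ∃ N : ℕ, ∀ R : ℕ, N ≤ R → ∃ a b c : ℕ, IsABCTriple a b c ∧ rad a b c ≤ R ∧ C * R < c :=
  Summit.ABC.ABC.Theorems.Target.Negative.exists_triple_linear_excess C

/-! **Quantitative form** (landed: `Summit.ABC.ABC.Theorems.Target.Negative.exists_triple_log_excess`,
file `Theorems/Target/Negative/LogExcessEveryScale.lean`, p109219; import deferred until the farm has built it):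
`∃ N, ∀ R ≥ N, ∃ abc, rad ≤ R ∧ R·log R < 600·c` with `N = 9^{2^{10}}` — `G(R) > R log R/600` at every scale,
so a `δ`-good scale of conjunct 2 needs `R^δ > log R / 600`. -/

/-- **(4b) "all large scales good" is exactly `ABC`** (so the quantifier `∃ R ≥ N` of conjunct 2 is
the whole difference between the crux's second half and the summit): if every `R ≥ N` is
`δ`-good then `c ≤ N^{1+δ} rad^{1+δ}` for every triple. Recorded as the implication
all-scales ⟹ ABC; the converse is `sparseGoodScales_of_abc` run at every scale. -/
theorem abc_of_allScalesGood
    (h : ∀ δ : ℝ, 0 < δ → ∃ N : ℕ, ∀ R : ℕ, N ≤ R → ∀ a b c : ℕ, IsABCTriple a b c →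
      rad a b c ≤ R → (c : ℝ) ≤ (R : ℝ) ^ (1 + δ)) : _root_.ABC := by
  rw [_root_.ABC_iff]
  intro ε hε
  obtain ⟨N, hN⟩ := h ε hε
  refine ⟨(max (N : ℝ) 1) ^ (1 + ε) + 1, by positivity, fun a b c habc => ?_⟩
  have hε1 : 0 < 1 + ε := by linarith
  have hrad0 : (0 : ℝ) ≤ rad a b c := Nat.cast_nonneg _
  have hrad1 : (1 : ℝ) ≤ rad a b c := by exact_mod_cast le_trans (by norm_num) (two_le_rad habc)
  have hradpow1 : (1 : ℝ) ≤ (rad a b c : ℝ) ^ (1 + ε) := Real.one_le_rpow hrad1 hε1.le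
  have hM1 : (1 : ℝ) ≤ max (N : ℝ) 1 := le_max_right _ _
  have hMpow1 : (1 : ℝ) ≤ (max (N : ℝ) 1) ^ (1 + ε) := Real.one_le_rpow hM1 hε1.le
  rcases le_or_gt N (rad a b c) with hle | hgt
  · have h1 := hN (rad a b c) hle a b c habc le_rfl
    calc (c : ℝ) ≤ (rad a b c : ℝ) ^ (1 + ε) := h1
      _ = 1 * (rad a b c : ℝ) ^ (1 + ε) := (one_mul _).symm
      _ < ((max (N : ℝ) 1) ^ (1 + ε) + 1) * (rad a b c : ℝ) ^ (1 + ε) := by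
          apply mul_lt_mul_of_pos_right _ (by positivity)
          linarith
  · have h1 := hN N le_rfl a b c habc hgt.le
    have hNM : (N : ℝ) ^ (1 + ε) ≤ (max (N : ℝ) 1) ^ (1 + ε) :=
      Real.rpow_le_rpow (Nat.cast_nonneg _) (le_max_left _ _) hε1.le
    calc (c : ℝ) ≤ (N : ℝ) ^ (1 + ε) := h1
      _ ≤ (max (N : ℝ) 1) ^ (1 + ε) := hNM
      _ = (max (N : ℝ) 1) ^ (1 + ε) * 1 := (mul_one _).symm
      _ ≤ (max (N : ℝ) 1) ^ (1 + ε) * (rad a b c : ℝ) ^ (1 + ε) := by gcongr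
      _ < ((max (N : ℝ) 1) ^ (1 + ε) + 1) * (rad a b c : ℝ) ^ (1 + ε) := by
          apply mul_lt_mul_of_pos_right _ (by positivity)
          linarith

/-! ## §5 Line SketchIdeator2 (ω-split): the two stubs -/

/-- Stub 1 of the line, verbatim (`= ∃ κ, BakerShapeExplicitABC κ`, item stmt-ABC-1756). -/
def Stub1BakerRefinement : Prop := ∃ κ : ℝ, Literature.Barriers.ABC.BakerShapeExplicitABC κ

/-- Stub 2 of the line, verbatim (ultra-composite tail, `∃ 0 < θ' < θ < 1`). -/
def Stub2UltraCompositeTail : Prop :=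
  ∃ θ' θ : ℝ, 0 < θ' ∧ θ' < θ ∧ θ < 1 ∧ ∃ A : ℝ, ∀ a b c : ℕ, IsABCTriple a b c →
    Real.log ((rad a b c : ℕ) : ℝ) ^ θ' < ((ArithmeticFunction.cardDistinctFactors (a * b * c) : ℕ) : ℝ) →
    (c : ℝ) < ((rad a b c : ℕ) : ℝ) * Real.exp (A * Real.log ((rad a b c : ℕ) : ℝ) ^ θ)

/-- The tail statement at fixed exponents (the line's `LargeOmegaSubPower θ' θ`). -/
def TailSubPower (θ' θ : ℝ) : Prop :=
  ∃ A : ℝ, ∀ a b c : ℕ, IsABCTriple a b c →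
    Real.log ((rad a b c : ℕ) : ℝ) ^ θ' < ((ArithmeticFunction.cardDistinctFactors (a * b * c) : ℕ) : ℝ) →
    (c : ℝ) < ((rad a b c : ℕ) : ℝ) * Real.exp (A * Real.log ((rad a b c : ℕ) : ℝ) ^ θ)

theorem stub2_iff : Stub2UltraCompositeTail ↔ ∃ θ' θ : ℝ, 0 < θ' ∧ θ' < θ ∧ θ < 1 ∧ TailSubPower θ' θ :=
  Iff.rfl

/-- **Joint sufficiency is a theorem** (tree: `Target.target_of_bakerShape_of_tail`): nothing is
smuggled by the line's glue. -/
theorem target_of_stubs (h₁ : Stub1BakerRefinement) (h₂ : Stub2UltraCompositeTail) : Target :=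
  Summit.ABC.ABC.Theorems.Target.target_of_bakerShape_of_tail h₁ h₂

/-- **Stub 1 needs `κ > 1.1997`** (Reyssat's triple; tree: `BakerShapeConstantFloor`). -/
theorem stub1_constant_floor {κ : ℝ} (h : Literature.Barriers.ABC.BakerShapeExplicitABC κ) : 1.1997 < κ := by
  by_contra hle
  exact Literature.Barriers.ABC.BakerShapeConstantFloor κ (not_lt.mp hle) h

/-- **Stub 2 is false below one half, even on the tail** (landed negative lemma
`Summit.ABC.ABC.Theorems.Target.Negative.not_tail_subpower_of_lt_half`, Stewart–Tijdeman with a forced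
divisor): for all `θ', θ < 1/2`, `¬ TailSubPower θ' θ`. -/
theorem not_tailSubPower_of_lt_half {θ' θ : ℝ} (hθ' : θ' < 1 / 2) (hθ : θ < 1 / 2) :
    ¬ TailSubPower θ' θ :=
  Summit.ABC.ABC.Theorems.Target.Negative.not_tail_subpower_of_lt_half hθ' hθ

/-- **Exponent floor of Stub 2**: every witness `(θ', θ, A)` with `θ' < θ` has `θ ≥ 1/2`
(landed: `Target.Negative.half_le_of_tail_subpower`). -/
theorem stub2_exponent_floor {θ' θ : ℝ} (hθ'θ : θ' < θ) (h : TailSubPower θ' θ) : 1 / 2 ≤ θ := by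
  obtain ⟨A, hA⟩ := h
  exact Summit.ABC.ABC.Theorems.Target.Negative.half_le_of_tail_subpower hθ'θ hA

/-- Hence the stub, if true at all, is witnessed only inside the window `1/2 ≤ θ < 1` — the same window
as the unrestricted sub-power slack: the restriction to `ω(abc) > (log rad)^{θ'}` buys no exponent. -/
theorem stub2_window (h : Stub2UltraCompositeTail) :
    ∃ θ' θ : ℝ, 0 < θ' ∧ θ' < θ ∧ 1 / 2 ≤ θ ∧ θ < 1 ∧ TailSubPower θ' θ := by
  obtain ⟨θ', θ, h0, h1, h2, hT⟩ := h
  exact ⟨θ', θ, h0, h1, stub2_exponent_floor h1 hT, h2, hT⟩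

/-! ## §6 Computation (card E1(b); kit jobs j016700, j016701 — numbers in the module docstring)

Evidence files `compute-j016700.json`, `compute-j016701.json` on stmt-ABC-2159 (outputs `B1000000/`,
`B10000000/`: `summary.txt`, `stats.json`, `G_steps.csv`, `triples.csv.gz`; script `compute/job/main.py`
in the seat folder).  Method: the two members of a triple with the smallest kernels `r ≤ s` satisfy
`r·s·max(r,s) ≤ B`, so both are products of prime powers over coprime kernels `≤ √B`; all such lift pairs
are enumerated and the third member is tested for `rad ≤ B/(rs)` by vectorised trial division; dedupe;
brute-force cross-check of every coprime `a + b = c ≤ 3000` (exact agreement).  The record function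
`G` has 25 steps on `[2, 10^7]` (`R: G` with the record triple): 2: 2 (1,1,2) · 6: 9 (1,8,9) · 30: 128
(3,125,128) · 66: 243 · 78: 256 · 102: 289 · 114: 513 · 210: 4375 (1,4374,4375) · 714: 6561 · 1110: 32805 ·
1218: 59392 · 2730: 85293 · 4290: 256000 · 7410: 390963 · 9030: 512001 · 14070: 1048576 · 15042: 6436343
(Reyssat, 2 + 3^10·109 = 23^5) · 53130: 48234496 (11² + 3²5⁶7³ = 2²¹·23) · 212610: 48889856 · 438090:
71744539 · 459690: 214375000 · 563178: 301327048 · 1133670: 474610336 · 1503310: 1919140864 · 1876290: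
8251953408 (283 + 5¹¹·13² = 2⁸·3⁸·17³, q = 1.5808).  The maximal pure ratios are all realised by a
record at the product scale against two non-record ("trough") scales, e.g. `G(22·684) = G(15048) =
6436343` against `G(22) = 9`, `G(684) = 4375` (log-ratio 5.10), and `G(48·1107)` = 48234496 against
`G(48) = 128`, `G(1107) = 6561` (4.05).
-/

end Summit.ABC.ABC.Cruxes.Target.Disproof
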